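import Mathlib
import Summits.PneNP.PneNP.Theorems.SfmBlMatrixToolkit

/-!
# The certificate return: a ±1 cut value of a rectangular matrix is controlled by the trace of an
even power of its bipartite symmetrisation — line «sfm-bl» (PROOF-SFM-BL Lemma 2(b) + Theorem §6 (iii)–(iv))

FRONTIER F-N1c; nothing here bears on P vs NP.

For a real `α × β` matrix `M` (the signed biadjacency of an edge class, rows = one side, columns = the
other) put `A := Matrix.fromBlocks 0 M Mᵀ 0`, the symmetric `(α ⊕ β) × (α ⊕ β)` matrix of the
bipartite graph.  For `z = (σ; φ)` one has `zᵀ A z = 2·σᵀ M φ` and, on `±1` vectors, `z·z = |α| + |β|`.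
Feeding this into `SfmBl.quadForm_pow_le_trace` (p3's eigenvalue-free toolkit) gives the ROOT-FREE form of
«`|σᵀMφ| ≤ ½·(|α|+|β|)·tr(A^L)^{1/L}`» for `L = 2^{j+2}`:
`(2·σᵀMφ)^L ≤ (|α|+|β|)^L · tr(A^L)` (`cut_pow_le_card_pow_mul_trace`), and the consumer form
`tr(A^L) ≤ r^L ⇒ |σᵀMφ| ≤ ½·(|α|+|β|)·r` (`abs_cut_le_of_trace_pow_le`).  This is how the sfm-bl greedy's
output inequality `tr(Ã_R^L) < A₁` returns to the cut-norm certificate on the sparse remainder `R`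
(PROOF-SFM-BL §6 (iii)–(iv); ref PREPARED-CHECKS S4b power form).  Also recorded: the trace of an even
power of `A` is a sum of squares, hence `≥ 0` (needed for the nonnegativity of the potential Ψ).
-/

namespace Summit.PneNP.PneNP.Theorems.SfmBl

open Matrix Finset BigOperators

-- universe-0 index types, matching `SfmBlMatrixToolkit` (`ι : Type`); all consumers use `Fin N`.
variable {α β : Type}

/-- The BIPARTITE SYMMETRISATION `fromBlocks 0 M Mᵀ 0` of a rectangular matrix (on `α ⊕ β`) is symmetric.
(No named definition is introduced: consumers write `Matrix.fromBlocks 0 M Mᵀ 0` directly.) -/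
theorem fromBlocks_transpose_isSymm (M : Matrix α β ℝ) : (Matrix.fromBlocks 0 M Mᵀ 0).IsSymm :=
  Matrix.IsSymm.fromBlocks Matrix.isSymm_zero rfl Matrix.isSymm_zero

variable [Fintype α] [Fintype β]

/-- The quadratic form of the symmetrisation is twice the bilinear cut form:
`(σ;φ)ᵀ · Matrix.fromBlocks 0 M Mᵀ 0 · (σ;φ) = 2·σᵀ M φ`. -/
theorem fromBlocks_quadForm (M : Matrix α β ℝ) (σ : α → ℝ) (φ : β → ℝ) :
    Sum.elim σ φ ⬝ᵥ (Matrix.fromBlocks 0 M Mᵀ 0 *ᵥ Sum.elim σ φ) = 2 * (σ ⬝ᵥ (M *ᵥ φ)) := by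
  rw [Matrix.fromBlocks_mulVec, sumElim_dotProduct_sumElim]
  have e1 : (Sum.elim σ φ ∘ Sum.inl : α → ℝ) = σ := by ext i; rfl
  have e2 : (Sum.elim σ φ ∘ Sum.inr : β → ℝ) = φ := by ext j; rfl
  simp only [e1, e2, Matrix.zero_mulVec, zero_add, add_zero]
  have h : φ ⬝ᵥ (Mᵀ *ᵥ σ) = σ ⬝ᵥ (M *ᵥ φ) := by
    rw [Matrix.mulVec_transpose, dotProduct_comm, Matrix.dotProduct_mulVec]
  rw [h]; ring

/-- On `±1` vectors the squared norm of `(σ;φ)` is the number of coordinates `|α| + |β|`. -/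
theorem sum_elim_dotProduct_self_of_pm (σ : α → ℝ) (φ : β → ℝ)
    (hσ : ∀ i, σ i = 1 ∨ σ i = -1) (hφ : ∀ j, φ j = 1 ∨ φ j = -1) :
    Sum.elim σ φ ⬝ᵥ Sum.elim σ φ = (Fintype.card α : ℝ) + Fintype.card β := by
  rw [sumElim_dotProduct_sumElim]
  have h1 : σ ⬝ᵥ σ = Fintype.card α := by
    have : ∀ i, σ i * σ i = 1 := fun i => by rcases hσ i with h | h <;> simp [h]
    simp only [dotProduct, this, Finset.sum_const, Finset.card_univ, nsmul_eq_mul, mul_one]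
  have h2 : φ ⬝ᵥ φ = Fintype.card β := by
    have : ∀ j, φ j * φ j = 1 := fun j => by rcases hφ j with h | h <;> simp [h]
    simp only [dotProduct, this, Finset.sum_const, Finset.card_univ, nsmul_eq_mul, mul_one]
  rw [h1, h2]

/-- The trace of an EVEN power of the symmetrisation is a sum of squares, hence nonnegative
(`tr(A^{2l}) = Σᵢⱼ (A^l)ᵢⱼ²`; used for the nonnegativity of the sfm-bl potential). -/
theorem trace_fromBlocks_pow_two_mul_nonneg [DecidableEq α] [DecidableEq β] (M : Matrix α β ℝ) (l : ℕ) :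
    0 ≤ ((Matrix.fromBlocks 0 M Mᵀ 0) ^ (2 * l)).trace := by
  rw [← sum_sq_pow_eq_trace (Matrix.fromBlocks 0 M Mᵀ 0) (fromBlocks_transpose_isSymm M) l]
  exact Finset.sum_nonneg fun i _ => Finset.sum_nonneg fun j _ => sq_nonneg _

/-- ROOT-FREE CERTIFICATE RETURN (PROOF-SFM-BL Lemma 2(b) in trace form): for every real `α × β`
matrix `M`, all `±1` vectors `σ, φ` and every `L = 2^{j+2}`,
`(2·σᵀMφ)^L ≤ (|α| + |β|)^L · tr((Matrix.fromBlocks 0 M Mᵀ 0)^L)`. -/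
theorem cut_pow_le_card_pow_mul_trace [DecidableEq α] [DecidableEq β] (M : Matrix α β ℝ)
    (σ : α → ℝ) (φ : β → ℝ) (hσ : ∀ i, σ i = 1 ∨ σ i = -1) (hφ : ∀ j, φ j = 1 ∨ φ j = -1) (j : ℕ) :
    (2 * (σ ⬝ᵥ (M *ᵥ φ))) ^ (2 ^ (j + 2))
      ≤ ((Fintype.card α : ℝ) + Fintype.card β) ^ (2 ^ (j + 2)) * ((Matrix.fromBlocks 0 M Mᵀ 0) ^ (2 ^ (j + 2))).trace := by
  have h := quadForm_pow_le_trace (Matrix.fromBlocks 0 M Mᵀ 0) (fromBlocks_transpose_isSymm M) (Sum.elim σ φ) j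
  rwa [fromBlocks_quadForm, sum_elim_dotProduct_self_of_pm σ φ hσ hφ] at h

/-- CONSUMER FORM: if `tr((Matrix.fromBlocks 0 M Mᵀ 0)^L) ≤ r^L` for some `r ≥ 0` and `L = 2^{j+2}`, then every `±1` cut value
obeys `|σᵀMφ| ≤ ½·(|α| + |β|)·r`.  (In PROOF-SFM-BL §6 (iii): `tr(Ã_R^L) < A₁ ≤ (√2·ρ̄)^L` gives
`Γ_R ≤ ½·√2·ρ̄·N_R`.) -/
theorem abs_cut_le_of_trace_pow_le [DecidableEq α] [DecidableEq β] (M : Matrix α β ℝ)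
    (σ : α → ℝ) (φ : β → ℝ) (hσ : ∀ i, σ i = 1 ∨ σ i = -1) (hφ : ∀ j, φ j = 1 ∨ φ j = -1) (j : ℕ)
    {r : ℝ} (hr : 0 ≤ r) (htr : ((Matrix.fromBlocks 0 M Mᵀ 0) ^ (2 ^ (j + 2))).trace ≤ r ^ (2 ^ (j + 2))) :
    |σ ⬝ᵥ (M *ᵥ φ)| ≤ ((Fintype.card α : ℝ) + Fintype.card β) * r / 2 := by
  set N : ℝ := (Fintype.card α : ℝ) + Fintype.card β with hN
  have hN0 : 0 ≤ N := by positivity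
  have h1 := cut_pow_le_card_pow_mul_trace M σ φ hσ hφ j
  have h2 : (2 * (σ ⬝ᵥ (M *ᵥ φ))) ^ (2 ^ (j + 2)) ≤ (N * r) ^ (2 ^ (j + 2)) := by
    calc (2 * (σ ⬝ᵥ (M *ᵥ φ))) ^ (2 ^ (j + 2)) ≤ N ^ (2 ^ (j + 2)) * ((Matrix.fromBlocks 0 M Mᵀ 0) ^ (2 ^ (j + 2))).trace := h1
      _ ≤ N ^ (2 ^ (j + 2)) * r ^ (2 ^ (j + 2)) := mul_le_mul_of_nonneg_left htr (pow_nonneg hN0 _)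
      _ = (N * r) ^ (2 ^ (j + 2)) := by rw [mul_pow]
  -- even exponent: `(2x)^L = |2x|^L`
  have heven : Even (2 ^ (j + 2)) := Nat.even_pow.mpr ⟨even_two, by omega⟩
  have h3 : |2 * (σ ⬝ᵥ (M *ᵥ φ))| ^ (2 ^ (j + 2)) ≤ (N * r) ^ (2 ^ (j + 2)) := by
    rwa [← Even.pow_abs heven] at h2
  have hL : 2 ^ (j + 2) ≠ 0 := by positivity
  have h4 : |2 * (σ ⬝ᵥ (M *ᵥ φ))| ≤ N * r :=
    le_of_pow_le_pow_left₀ hL (mul_nonneg hN0 hr) h3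
  rw [abs_mul, abs_two] at h4
  linarith
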